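import Summits.CriticalPhenomena.Ising3D.TaylorRegionDeltaRowsS
import Summits.CriticalPhenomena.Ising3D.TaylorTableOddHeadDeltaRows
import Summits.CriticalPhenomena.Ising3D.TaylorTableEvenHeadDeltaRows
import Mathlib.Tactic.Linarith
import Mathlib.Tactic.Positivity
import Mathlib.Tactic.Ring
import HarnessLib

/-!
# Head-row contracts from literal δ-tables with the SIGNED second-order slot (S twins of `OddHeadRowsΔ.validΔ_of_lit` / `HeadRowsΔ.validΔ_of_lit`)
(cell `pub-ising3x`, seat boot-1 gen 16; T2′ (a) of lead RULING R24-γ)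

HONEST FRAMING: lottery ticket; floor = tightest certified 3D Ising CFT bounds; no exact-solution
claim without a proof. Island framing: certified exclusion region at stated derivative order and
assumptions; not a determination of the 3D Ising critical exponents beyond that.

The odd / even head layers take their row triples through the contracts `OddHeadRowsΔ.ValidΔ` / `HeadRowsΔ.ValidΔ` (UNCHANGED). This file
discharges them from literal δ-tables whose slot 2 is checked against `deltaT2S` (`tabOKcS`, `sizesOKS`), i.e. from S-format row sets: proofs are the
originals verbatim with `qSum_eq_delta_rows ↦ qSum_eq_delta_rowsS`, `pmem3_tripL ↦ pmem3_tripLS`. [folklore]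
-/

namespace Summit.CriticalPhenomena.Ising3D

open Finset Set
open Literature.Analysis.ValidatedNumerics Literature.Analysis.ValidatedNumerics.PolyMP
open Literature.Analysis.ValidatedNumerics.NumericsMP (MI)
open Literature.MathematicalPhysics.QuantumFieldTheory.ConformalBootstrap3D

/-! ### Odd sector -/

namespace OddConeRegionDataΔ

variable (d : OddConeRegionDataΔ)

/-- δ-table containment of component `c`, order `m`, slot 2 against the SIGNED table. [folklore] -/
def tabOKcS (TT : ITab3x5) (c m : ℕ) : Bool :=
  tabOKS d.S (d.compC c) (OddConeRegionDataΔ.compσ c) (d.comps₀ c) (d.compW c) d.ccQ (d.compL c) (proj5 TT c) m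

/-- Size side conditions with the signed tables. [folklore] -/
def sizesOKS : Bool :=
  d.toCertH.data.sizesOK && decide (d.σlo ≤ d.σhi) && decide (d.εlo ≤ d.εhi) &&
  deltaSizeOKS d.S (d.cQ 2) (-1) d.b0 d.Wb d.ccQ d.l d.N && deltaSizeOKS d.S (d.cQ 3) (-1) d.σ0 d.Wσ d.ccQ d.l d.N &&
  deltaSizeOKS d.S (d.cQ 4) 1 d.σ0 d.Wσ d.ccQ d.l d.N && deltaSizeOKS d.S d.ψQ 0 0 0 d.ccQ d.lψ d.N &&
  deltaSizeOKS d.S d.ψQ 0 d.t0 d.Wt d.ccQ d.lψ d.N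

end OddConeRegionDataΔ

namespace OddHeadRowsΔ

/-- **`ValidΔ` from literal δ-tables with the SIGNED second-order slot** (S-format odd row sets). [folklore] -/
theorem validΔ_of_litS (d : OddConeRegionDataΔ) (TT : ITab3x5) (L : List OddLit) (J : ℕ) (hl : d.l.Nodup)
    (hlψ : d.lψ.Nodup) (hs : d.sizesOKS = true) (hcc : d.ccQ = 0)
    (hT : ∀ c m : ℕ, c < 5 → m < 3 → d.tabOKcS TT c m = true) (hr : ∀ j : ℕ, j < J → d.rowLitOKL TT L j = true) :
    (⟨d.S, J, d.σ0, d.Wσ, d.ε0, d.Wε, L⟩ : OddHeadRowsΔ).ValidΔ d.cQ d.l d.ψQ d.lψ d.σlo d.σhi d.εlo d.εhi := by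
  simp only [OddConeRegionDataΔ.sizesOKS, OddConeRegionDataH.sizesOK, Bool.and_eq_true, decide_eq_true_eq] at hs
  obtain ⟨⟨⟨⟨⟨⟨⟨hsz, hσ⟩, hε⟩, hZ3⟩, hZ4⟩, hZ5⟩, hZψ0⟩, hZψt⟩ := hs
  obtain ⟨⟨⟨⟨⟨⟨⟨⟨hS, _⟩, _⟩, _⟩, _⟩, _⟩, _⟩, _⟩, _⟩ := hsz
  have hS : 0 < d.S := hS
  have hWσ : 0 ≤ d.Wσ := by unfold OddConeRegionDataΔ.Wσ; linarith
  have hWε : 0 ≤ d.Wε := by unfold OddConeRegionDataΔ.Wε; linarith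
  have hWb : 0 ≤ d.Wb := by unfold OddConeRegionDataΔ.Wb; linarith
  have hWt : 0 ≤ d.Wt := by unfold OddConeRegionDataΔ.Wt; linarith
  have t3 : ∀ m : ℕ, m < 3 → tabOKS d.S (d.cQ 2) (-1) d.b0 d.Wb d.ccQ d.l TT.1 m = true :=
    fun m hm => hT 0 m (by norm_num) hm
  have t4 : ∀ m : ℕ, m < 3 → tabOKS d.S (d.cQ 3) (-1) d.σ0 d.Wσ d.ccQ d.l TT.2.1 m = true :=
    fun m hm => hT 1 m (by norm_num) hm
  have t5 : ∀ m : ℕ, m < 3 → tabOKS d.S (d.cQ 4) 1 d.σ0 d.Wσ d.ccQ d.l TT.2.2.1 m = true :=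
    fun m hm => hT 2 m (by norm_num) hm
  have tψ0 : ∀ m : ℕ, m < 3 → tabOKS d.S d.ψQ 0 0 0 d.ccQ d.lψ TT.2.2.2.1 m = true :=
    fun m hm => hT 3 m (by norm_num) hm
  have tψt : ∀ m : ℕ, m < 3 → tabOKS d.S d.ψQ 0 d.t0 d.Wt d.ccQ d.lψ TT.2.2.2.2 m = true :=
    fun m hm => hT 4 m (by norm_num) hm
  refine ⟨hS, hWσ, hWε, fun p hp => ?_⟩
  obtain ⟨h1, h2, h3, h4⟩ : (d.σlo : ℝ) ≤ p.1 ∧ p.1 ≤ d.σhi ∧ (d.εlo : ℝ) ≤ p.2 ∧ p.2 ≤ d.εhi := by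
    simp only [Set.mem_prod, Set.mem_Icc] at hp; exact ⟨hp.1.1, hp.1.2, hp.2.1, hp.2.2⟩
  have hδσ : |p.1 - d.σ0| ≤ d.Wσ := by
    unfold OddConeRegionDataΔ.σ0 OddConeRegionDataΔ.Wσ; push_cast; rw [abs_le]; constructor <;> linarith
  have hδε : |p.2 - d.ε0| ≤ d.Wε := by
    unfold OddConeRegionDataΔ.ε0 OddConeRegionDataΔ.Wε; push_cast; rw [abs_le]; constructor <;> linarith
  have hδb : |(p.1 + p.2) / 2 - d.b0| ≤ d.Wb := by
    unfold OddConeRegionDataΔ.b0 OddConeRegionDataΔ.Wb OddConeRegionDataΔ.σ0 OddConeRegionDataΔ.Wσ OddConeRegionDataΔ.ε0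
      OddConeRegionDataΔ.Wε
    push_cast; rw [abs_le]; constructor <;> linarith
  have hδt : |(p.1 - p.2) - d.t0| ≤ d.Wt := by
    unfold OddConeRegionDataΔ.t0 OddConeRegionDataΔ.Wt OddConeRegionDataΔ.σ0 OddConeRegionDataΔ.Wσ
      OddConeRegionDataΔ.ε0 OddConeRegionDataΔ.Wε
    push_cast; rw [abs_le]; constructor <;> linarith
  have hδ0 : |(0 : ℝ)| ≤ ((0 : ℚ) : ℝ) := by simp
  refine ⟨hδσ, hδε, fun j hj => ?_⟩
  have hcc' : ((d.ccQ : ℚ) : ℝ) = 0 := by rw [hcc]; push_cast; rfl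
  -- q-sums as triples
  have e3 := qSum_eq_delta_rowsS hS (d.cQ 2) (-1) d.b0 hWb d.ccQ hl hZ3 hδb
  have e4 := qSum_eq_delta_rowsS hS (d.cQ 3) (-1) d.σ0 hWσ d.ccQ hl hZ4 hδσ
  have e5 := qSum_eq_delta_rowsS hS (d.cQ 4) 1 d.σ0 hWσ d.ccQ hl hZ5 hδσ
  have eψ0 := qSum_eq_delta_rowsS hS d.ψQ 0 0 le_rfl d.ccQ hlψ hZψ0 hδ0
  have eψt := qSum_eq_delta_rowsS hS d.ψQ 0 d.t0 hWt d.ccQ hlψ hZψt hδt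
  have ab : ((d.b0 : ℚ) : ℝ) + ((p.1 + p.2) / 2 - d.b0) = (p.1 + p.2) / 2 := by ring
  have aσ : ((d.σ0 : ℚ) : ℝ) + (p.1 - d.σ0) = p.1 := by ring
  have a0 : (((0 : ℚ) : ℚ) : ℝ) + (0 : ℝ) = 0 := by simp
  have at' : ((d.t0 : ℚ) : ℝ) + ((p.1 - p.2) - d.t0) = p.1 - p.2 := by ring
  rw [ab] at e3; rw [aσ] at e4 e5; rw [a0] at eψ0; rw [at'] at eψt
  simp only [Rat.cast_neg, Rat.cast_one, Rat.cast_zero, hcc', sub_zero] at e3 e4 e5 eψ0 eψt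
  -- memberships in the triples from the literal tables, then in the literal rows
  have q3 := pmem3_tripLS hS (d.cQ 2) (-1) d.b0 hWb d.ccQ d.l t3 d.N j hδb
  have q4 := pmem3_tripLS hS (d.cQ 3) (-1) d.σ0 hWσ d.ccQ d.l t4 d.N j hδσ
  have q5 := pmem3_tripLS hS (d.cQ 4) 1 d.σ0 hWσ d.ccQ d.l t5 d.N j hδσ
  have qψ0 := pmem3_tripLS hS d.ψQ 0 0 le_rfl d.ccQ d.lψ tψ0 d.N j hδ0
  have qψt := pmem3_tripLS hS d.ψQ 0 d.t0 hWt d.ccQ d.lψ tψt d.N j hδt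
  have hrow := hr j hj
  simp only [OddConeRegionDataΔ.rowLitOKL, OddConeRegionDataΔ.rowLitRowOK, Bool.and_eq_true] at hrow
  obtain ⟨⟨⟨⟨s3, s4⟩, s5⟩, sψ0⟩, sψt⟩ := hrow
  have m3 := pmem3_of_subset3 q3 s3
  have m4 := pmem3_of_subset3 q4 s4
  have m5 := pmem3_of_subset3 q5 s5
  have mψ0 := pmem3_of_subset3 qψ0 sψ0
  have mψt := pmem3_of_subset3 qψt sψt
  refine ⟨⟨_, m3, fun E => ?_⟩, ⟨_, m4, fun E => ?_⟩, ⟨_, m5, fun E => ?_⟩, ⟨_, mψ0, fun E => ?_⟩, ⟨_, mψt, fun E => ?_⟩⟩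
  · rw [e3 E j, show (⟨d.S, J, d.σ0, d.Wσ, d.ε0, d.Wε, L⟩ : OddHeadRowsΔ).b0 = d.b0 from rfl]; simp only [val3]
  · rw [e4 E j]; simp only [val3]
  · rw [e5 E j]; simp only [val3]
  · rw [eψ0 E j]; simp only [val3]
  · rw [eψt E j, show (⟨d.S, J, d.σ0, d.Wσ, d.ε0, d.Wε, L⟩ : OddHeadRowsΔ).t0 = d.t0 from rfl]; simp only [val3]

end OddHeadRowsΔ

/-! ### Even sector -/

namespace EvenRegionDataΔ

variable (d : EvenRegionDataΔ)

/-- δ-table containment of component `c`, order `m`, slot 2 against the SIGNED table. [folklore] -/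
def tabOKcS (TT : ITab3 × ITab3 × ITab3 × ITab3) (c m : ℕ) : Bool :=
  tabOKS d.S (d.compC c) (EvenRegionDataΔ.compσ c) (d.comps₀ c) (d.compW c) d.ccQ d.l (proj4 TT c) m

/-- Size side conditions with the signed tables. [folklore] -/
def sizesOKS : Bool :=
  d.toH.sizesOK && decide (d.σlo ≤ d.σhi) && decide (d.εlo ≤ d.εhi) &&
  deltaSizeOKS d.S (d.cQ 0) (-1) d.σ0 d.Wσ d.ccQ d.l d.N && deltaSizeOKS d.S (d.cQ 1) (-1) d.ε0 d.Wε d.ccQ d.l d.N &&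
  deltaSizeOKS d.S (d.cQ 3) (-1) d.b0 d.Wb d.ccQ d.l d.N && deltaSizeOKS d.S (d.cQ 4) 1 d.b0 d.Wb d.ccQ d.l d.N

end EvenRegionDataΔ

namespace HeadRowsΔ

/-- **`ValidΔ` (even head rows) from literal δ-tables with the SIGNED second-order slot** (S-format even row sets). [folklore] -/
theorem validΔ_of_litS (d : EvenRegionDataΔ) (TT : ITab3 × ITab3 × ITab3 × ITab3)
    (L : List (ITriple × ITriple × ITriple)) (J : ℕ) (hl : d.l.Nodup) (hs : d.sizesOKS = true) (hcc : d.ccQ = 0)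
    (hT : ∀ c m : ℕ, c < 4 → m < 3 → d.tabOKcS TT c m = true) (hr : ∀ j : ℕ, j < J → d.rowLitOKL TT L j = true) :
    (⟨d.S, J, d.σ0, d.Wσ, d.ε0, d.Wε, L⟩ : HeadRowsΔ).ValidΔ d.cQ d.l d.σlo d.σhi d.εlo d.εhi := by
  simp only [EvenRegionDataΔ.sizesOKS, EvenRegionDataH.sizesOK, Bool.and_eq_true, decide_eq_true_eq] at hs
  obtain ⟨⟨⟨⟨⟨⟨⟨⟨⟨⟨⟨⟨⟨⟨⟨⟨⟨hS, _⟩, _⟩, _⟩, _⟩, _⟩, _⟩, _⟩, _⟩, _⟩, _⟩, _⟩, hσ⟩, hε⟩,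
    hZX⟩, hZY⟩, hZ3⟩, hZ4⟩ := hs
  have hS : 0 < d.S := hS
  have hWσ : 0 ≤ d.Wσ := by unfold EvenRegionDataΔ.Wσ; linarith
  have hWε : 0 ≤ d.Wε := by unfold EvenRegionDataΔ.Wε; linarith
  have hWb : 0 ≤ d.Wb := by unfold EvenRegionDataΔ.Wb; linarith
  have tX : ∀ m : ℕ, m < 3 → tabOKS d.S (d.cQ 0) (-1) d.σ0 d.Wσ d.ccQ d.l TT.1 m = true :=
    fun m hm => hT 0 m (by norm_num) hm
  have tY : ∀ m : ℕ, m < 3 → tabOKS d.S (d.cQ 1) (-1) d.ε0 d.Wε d.ccQ d.l TT.2.1 m = true :=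
    fun m hm => hT 1 m (by norm_num) hm
  have t3 : ∀ m : ℕ, m < 3 → tabOKS d.S (d.cQ 3) (-1) d.b0 d.Wb d.ccQ d.l TT.2.2.1 m = true :=
    fun m hm => hT 2 m (by norm_num) hm
  have t4 : ∀ m : ℕ, m < 3 → tabOKS d.S (d.cQ 4) 1 d.b0 d.Wb d.ccQ d.l TT.2.2.2 m = true :=
    fun m hm => hT 3 m (by norm_num) hm
  refine ⟨hS, hWσ, hWε, fun p hp => ?_⟩
  obtain ⟨h1, h2, h3, h4⟩ : (d.σlo : ℝ) ≤ p.1 ∧ p.1 ≤ d.σhi ∧ (d.εlo : ℝ) ≤ p.2 ∧ p.2 ≤ d.εhi := by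
    simp only [Set.mem_prod, Set.mem_Icc] at hp; exact ⟨hp.1.1, hp.1.2, hp.2.1, hp.2.2⟩
  have hδσ : |p.1 - d.σ0| ≤ d.Wσ := by
    unfold EvenRegionDataΔ.σ0 EvenRegionDataΔ.Wσ; push_cast; rw [abs_le]; constructor <;> linarith
  have hδε : |p.2 - d.ε0| ≤ d.Wε := by
    unfold EvenRegionDataΔ.ε0 EvenRegionDataΔ.Wε; push_cast; rw [abs_le]; constructor <;> linarith
  have hδb : |(p.1 + p.2) / 2 - d.b0| ≤ d.Wb := by
    unfold EvenRegionDataΔ.b0 EvenRegionDataΔ.Wb EvenRegionDataΔ.σ0 EvenRegionDataΔ.Wσ EvenRegionDataΔ.ε0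
      EvenRegionDataΔ.Wε
    push_cast; rw [abs_le]; constructor <;> linarith
  refine ⟨hδσ, hδε, fun j hj => ?_⟩
  have hcc' : ((d.ccQ : ℚ) : ℝ) = 0 := by rw [hcc]; push_cast; rfl
  have eX := qSum_eq_delta_rowsS hS (d.cQ 0) (-1) d.σ0 hWσ d.ccQ hl hZX hδσ
  have eY := qSum_eq_delta_rowsS hS (d.cQ 1) (-1) d.ε0 hWε d.ccQ hl hZY hδε
  have eZ3 := qSum_eq_delta_rowsS hS (d.cQ 3) (-1) d.b0 hWb d.ccQ hl hZ3 hδb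
  have eZ4 := qSum_eq_delta_rowsS hS (d.cQ 4) 1 d.b0 hWb d.ccQ hl hZ4 hδb
  have aσ : ((d.σ0 : ℚ) : ℝ) + (p.1 - d.σ0) = p.1 := by ring
  have aε : ((d.ε0 : ℚ) : ℝ) + (p.2 - d.ε0) = p.2 := by ring
  have ab : ((d.b0 : ℚ) : ℝ) + ((p.1 + p.2) / 2 - d.b0) = (p.1 + p.2) / 2 := by ring
  rw [aσ] at eX; rw [aε] at eY; rw [ab] at eZ3 eZ4
  simp only [Rat.cast_neg, Rat.cast_one, hcc', sub_zero] at eX eY eZ3 eZ4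
  have qX := pmem3_tripLS hS (d.cQ 0) (-1) d.σ0 hWσ d.ccQ d.l tX d.N j hδσ
  have qY := pmem3_tripLS hS (d.cQ 1) (-1) d.ε0 hWε d.ccQ d.l tY d.N j hδε
  have q3 := pmem3_tripLS hS (d.cQ 3) (-1) d.b0 hWb d.ccQ d.l t3 d.N j hδb
  have q4 := pmem3_tripLS hS (d.cQ 4) 1 d.b0 hWb d.ccQ d.l t4 d.N j hδb
  have qZ := pmem3_add q3 q4
  have hrow := hr j hj
  simp only [EvenRegionDataΔ.rowLitOKL, EvenRegionDataΔ.rowLitRowOK, Bool.and_eq_true] at hrow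
  obtain ⟨⟨sX, sY⟩, sZ⟩ := hrow
  have mX := pmem3_of_subset3 qX sX
  have mY := pmem3_of_subset3 qY sY
  have mZ := pmem3_of_subset3 qZ sZ
  refine ⟨⟨_, mX, fun E => ?_⟩, ⟨_, mY, fun E => ?_⟩, ⟨_, mZ, fun E => ?_⟩⟩
  · rw [eX E j]; simp only [val3]
  · rw [eY E j]; simp only [val3]
  · rw [eZ3 E j, eZ4 E j, show (⟨d.S, J, d.σ0, d.Wσ, d.ε0, d.Wε, L⟩ : HeadRowsΔ).b0 = d.b0 from rfl]
    simp only [val3, evalR_addR]; ring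

end HeadRowsΔ

/-! ### `sizesOKS` from its parts (recog-1 g22 addendum for the S-format literal set emitters mg2_rows_s2.py / mg2_rows_even.py,
which prove the size side conditions part by part exactly as the symmetric sets do via `TaylorRegionDeltaLitSizes.sizesOK_of_parts`) -/

namespace OddConeRegionDataΔ

/-- **`sizesOKS` from its parts** (odd; signed δ²-slot tables). [folklore] -/
theorem sizesOKS_of_parts (d : OddConeRegionDataΔ) (h0 : d.toCertH.data.sizesOK = true) (hσ : d.σlo ≤ d.σhi)
    (hε : d.εlo ≤ d.εhi) (h3 : deltaSizeOKS d.S (d.cQ 2) (-1) d.b0 d.Wb d.ccQ d.l d.N = true)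
    (h4 : deltaSizeOKS d.S (d.cQ 3) (-1) d.σ0 d.Wσ d.ccQ d.l d.N = true)
    (h5 : deltaSizeOKS d.S (d.cQ 4) 1 d.σ0 d.Wσ d.ccQ d.l d.N = true)
    (hψ0 : deltaSizeOKS d.S d.ψQ 0 0 0 d.ccQ d.lψ d.N = true)
    (hψt : deltaSizeOKS d.S d.ψQ 0 d.t0 d.Wt d.ccQ d.lψ d.N = true) : d.sizesOKS = true := by
  simp only [sizesOKS, h0, h3, h4, h5, hψ0, hψt, hσ, hε, decide_true, Bool.and_self]

end OddConeRegionDataΔ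

namespace EvenRegionDataΔ

/-- **`sizesOKS` from its parts** (even; signed δ²-slot tables). [folklore] -/
theorem sizesOKS_of_parts (d : EvenRegionDataΔ) (h0 : d.toH.sizesOK = true) (hσ : d.σlo ≤ d.σhi) (hε : d.εlo ≤ d.εhi)
    (hX : deltaSizeOKS d.S (d.cQ 0) (-1) d.σ0 d.Wσ d.ccQ d.l d.N = true)
    (hY : deltaSizeOKS d.S (d.cQ 1) (-1) d.ε0 d.Wε d.ccQ d.l d.N = true)
    (h3 : deltaSizeOKS d.S (d.cQ 3) (-1) d.b0 d.Wb d.ccQ d.l d.N = true)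
    (h4 : deltaSizeOKS d.S (d.cQ 4) 1 d.b0 d.Wb d.ccQ d.l d.N = true) : d.sizesOKS = true := by
  simp only [sizesOKS, h0, hX, hY, h3, h4, hσ, hε, decide_true, Bool.and_self]

end EvenRegionDataΔ

end Summit.CriticalPhenomena.Ising3D
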